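import Summits.ResolutionOfSingularities.ResolutionOfSingularities.Theorems.MarkedTransferCampaignW36SupplyTBHolds
import HarnessLib

/-!
# [L1 W3.6 · GAP-LEDGER R12/12a residual ON 𝒞] ⟨StableTower `b₀ ≤ b(A)`⟩ on the door's class HOLDS OUTRIGHT, with ONE level per
# ambient datum: `∃ b > 0, CampaignW36.HatStableTowerLEOn LCIOrMonomialClass IsEdgeData b A n` — UNCONDITIONAL

Cell `res-hironaka`, rung L, slot W3.6 «ord-pow cut», seat res-L1-s36-pv-2 (gen 0, closing brick). HOST item stmt-ResolutionOfSingularities-16155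
via `--supports`. HONEST FRAMING (D-0012/D-0089): kernel theorems about OUR typed objects (`S06BaseHike.diffPower` / `StableAt`, o4's classes and
`CampaignW36.HatStableTowerLEOn`, p487786); nothing printed in [Hironaka2017] is asserted and the manuscript stays «under review». AI-produced
kernel proofs with standard axioms and NO named premise.

STATE OF THE DOOR (2026-08-27T04:10Z): «`U30_2_R2_inst`∣𝒞» = `campaignW36CoreFocusExists_lciOrMonomial_holds p` is a CLOSED kernel theorem
(res-L1-s36-pv-1 p494780 `…SupplyTBHolds`, over this seat's stalkwise glue p492546/p493137/p493656 and res-L1-s36-pv-1's coordinate-prime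
Herzog–Hibi–Trung `exists_uniform_rsop_veronese_holds`, W3.1 by res-type-076 p491140, T-A by res-D-pv-025 p490274). This file adds the
UNIFORMITY that the typed T-AB hides: the Veronese level, hence the stabilisation level of the tower of candidates
`b ↦ 𝔖(Ê) ∩ 𝔖((𝓘_{Σ̄_max}^{⟨b⟩}, b))`, can be chosen ONCE PER AMBIENT DATUM (`b = b(N)` for a bound `N ≥ dim 𝒪_{Z,x}`), for ALL standard
`E` on `A.Z` whose `Σ̄_max` lies in `𝒞` — the modulo-fact version is `exists_hatStableTowerLEOn_lciOrMonomial_of_HHT` (p494965).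

* `CampaignW36.exists_uniform_veronese_lciOrMonomial_holds` — `∃ b₀ > 0, ∀ C` mixed-class, `∀ k, 𝓘_C^{⟨k b₀⟩} ≤ (𝓘_C^{⟨b₀⟩})^k`;
* `CampaignW36.exists_hatStableTowerLEOn_lciOrMonomial_holds` — `∃ b > 0, HatStableTowerLEOn LCIOrMonomialClass IsEdgeData b A n`;
  `exists_hatStableTowerLEOn_monomial_holds` (B-type class); and the A-type class at level `1` is res-D-pv-025's `hatStableTowerLEOn_lci`.
-/

noncomputable section

set_option linter.dupNamespace false -- mandated namespace of this single-conjunct summit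

open _root_.AlgebraicGeometry _root_.TopologicalSpace _root_.CategoryTheory _root_.IsLocalRing

namespace Summit.ResolutionOfSingularities.ResolutionOfSingularities.Theorems

open Literature.AlgebraicGeometry.Resolution
open Literature.AlgebraicGeometry.Hironaka2017
open Literature.AlgebraicGeometry.Hironaka2017.S02Preliminaries
open Literature.AlgebraicGeometry.Hironaka2017.S04CharAlgebra
open Literature.AlgebraicGeometry.Hironaka2017.S06BaseHike
open Literature.AlgebraicGeometry.Hironaka2017.Datum
open Scheme.IdealSheafData

universe u

namespace CampaignW36

variable {p : ℕ} [Fact p.Prime] {K : Type u} [Field K] [CharP K p]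

omit [Fact p.Prime] in
/-- The embedding dimension of a regular local ring of dimension `≤ N` is `≤ N` (local copy of the private helper of `…SupplyTAB`). [folklore] -/
private theorem spanFinrank_le_of_ringKrullDim_le'' {R : Type u} [CommRing R] [IsRegularLocalRing R] {d N : ℕ}
    (hd : (maximalIdeal R).spanFinrank = d) (hN : ringKrullDim R ≤ N) : d ≤ N := by
  have h := IsRegularLocalRing.spanFinrank_maximalIdeal (R := R)
  rw [hd] at h
  have : ((d : ℕ∞) : WithBot ℕ∞) ≤ ((N : ℕ∞) : WithBot ℕ∞) := h.le.trans hN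
  exact_mod_cast this

/-- **T-AB WITH ONE LEVEL PER AMBIENT DATUM, UNCONDITIONAL**: for every ambient datum `A` there is `b₀ > 0` such that every closed
`C ⊆ A.Z` that is A-type (`IsLCICutAt`) or B-type (`IsMonomialCutAt`) at each of its points satisfies `𝓘_C^{⟨k b₀⟩} ≤ (𝓘_C^{⟨b₀⟩})^k` for
all `k` — `b₀ = b₀(N)` for any `N ≥ dim 𝒪_{Z,x}` (res-L1-s36-pv-1's `exists_uniform_rsop_veronese_holds`), glued stalkwise. NOT a statement of
the manuscript. [cite: HerzogHibiTrung2007, Cor. 2.2 (coordinate-prime case, kernel-proved)] [cite: Matsumura1987, Thm. 16.2] -/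
theorem exists_uniform_veronese_lciOrMonomial_holds (A : AmbientDatum p K) :
    ∃ b₀ : ℕ, 0 < b₀ ∧ ∀ C : Closeds A.Z, (∀ x ∈ (C : Set A.Z), IsLCICutAt C x ∨ IsMonomialCutAt C x) →
      ∀ k : ℕ, diffPower C (k * b₀) ≤ diffPower C b₀ ^ k := by
  haveI := A.smooth
  haveI := A.quasiCompact
  haveI := Scheme.isNoetherian_of_finiteType_over_field A.hom
  obtain ⟨N, hN⟩ := exists_nat_ringKrullDim_stalk_le A
  obtain ⟨b₀, hb₀, hV⟩ := exists_uniform_rsop_veronese_holds.{u} N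
  refine ⟨b₀, hb₀, fun C hC k => diffPower_mul_le_pow_of_forall_stalk C fun x hx => ?_⟩
  rcases hC x hx with hAx | hBx
  · obtain ⟨rs, hreg, hI⟩ := hAx
    exact stalk_veronese_of_isWeaklyRegularAt C ⟨rs, hreg.toIsWeaklyRegular, hI⟩ b₀ k
  · obtain ⟨d, z, ⟨hreg, hz, hd⟩, 𝒮, h𝒮⟩ := hBx
    haveI := hreg
    have hC' : stalkIdeal (vanishingIdeal C) x = 𝒮.inf fun S => Ideal.span (z '' (S : Set (Fin d))) := by
      rw [h𝒮, Finset.inf_eq_iInf]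
    exact stalk_veronese_of_rsop hd z hz 𝒮 hC'
      (hV _ d (spanFinrank_le_of_ringKrullDim_le'' hd (hN x)) hd z hz 𝒮 k)

variable {IsEdgeData : ∀ ⦃X : Scheme.{u}⦄ ⦃p n : ℕ⦄ (E : IdealExponent X) (ξ : X), EdgeDatumAt p n E ξ → Prop}
variable [PerfectField K] {A : AmbientDatum p K} {n : ℕ}

/-- **⟨StableTower `b₀ ≤ b`⟩ ON THE DOOR'S CLASS `𝒞 = LCIOrMonomialClass` HOLDS with `b = b(A)`**, UNCONDITIONAL:
`∃ b > 0, HatStableTowerLEOn LCIOrMonomialClass IsEdgeData b A n` — for every standard `E` on `A.Z` with `0 < Ê.b` whose `Σ̄_max` is, at each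
of its points, an l.c.i. cut or a reduced union of coordinate subspaces of an r.s.p., the tower of candidates is stable at the level `b(A)`
(res-type-010's `stableAt_of_veronese`, p480948) — GAP-LEDGER R12/12a's residual ⟨StableTower⟩ on `𝒞`, with a bound uniform in `E`. NOT a
statement of the manuscript. [cite: HerzogHibiTrung2007, Cor. 2.2 (coordinate-prime case, kernel-proved)] -/
theorem exists_hatStableTowerLEOn_lciOrMonomial_holds :
    ∃ b : ℕ, 0 < b ∧ HatStableTowerLEOn LCIOrMonomialClass IsEdgeData b A n := by
  obtain ⟨b₀, hb₀, hV⟩ := exists_uniform_veronese_lciOrMonomial_holds A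
  refine ⟨b₀, hb₀, fun E ed _ hb _ hC => ?_⟩
  haveI := A.smooth
  haveI := A.quasiCompact
  haveI := Scheme.isNoetherian_of_finiteType_over_field A.hom
  exact ⟨b₀, hb₀, le_rfl, stableAt_of_veronese A.isRegular_Z (baseHike E) hb _ hb₀ (hV _ hC)⟩

/-- **⟨StableTower `b₀ ≤ b(A)`⟩ on the B-type class HOLDS**, UNCONDITIONAL. NOT a statement of the manuscript.
[cite: HerzogHibiTrung2007, Cor. 2.2 (coordinate-prime case, kernel-proved)] -/
theorem exists_hatStableTowerLEOn_monomial_holds :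
    ∃ b : ℕ, 0 < b ∧ HatStableTowerLEOn MonomialClass IsEdgeData b A n := by
  obtain ⟨b, hb, h⟩ := exists_hatStableTowerLEOn_lciOrMonomial_holds (IsEdgeData := IsEdgeData) (A := A) (n := n)
  exact ⟨b, hb, fun E ed hE hb' hed hC => h E ed hE hb' hed (monomialClass_le _ _ hC)⟩

end CampaignW36

end Summit.ResolutionOfSingularities.ResolutionOfSingularities.Theorems

end
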